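import Literature.Topology.PlaneTopology.AnnulusLogarithm
import Literature.Topology.PlaneTopology.ZerosPersist
import Literature.Analysis.Complex.ArgumentPrincipleWinding

/-!
# Extension of a zero-free planar map of total index zero across its punctures
(registered helper `helper_planarIndexZeroExtension` of the stub `stub_normalWitnessTransfer`, line
`cross-cap-laurent`, crux `GromovRecognitionRelEnd`, item stmt-SmoothPoincare4-11009)

Setting: `φ : ℂ → ℂ` continuous and zero-free on the closed disc `‖z‖ ≤ R₁` minus a finite set `Z`
of punctures, every puncture `ζ` with its closed `r`-disc inside `‖z‖ < R₀` (`R₀ < R₁`), the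
`r`-discs pairwise disjoint, and total index `∑_{ζ ∈ Z} wind (φ ∘ circleLoop ζ r) = 0`
(`Literature.Topology.PlaneTopology.wind`, `circleLoop`).  Claim (`helper_planarIndexZeroExtension`):
there is `ψ` continuous and zero-free on the whole closed disc `‖z‖ ≤ R₁` with `ψ = φ` on
`R₀ ≤ ‖z‖`.  In the lead's proof this turns "total index `0`" of a direction field into a
nowhere-zero section.

Proof: the argument principle for continuous zero-free maps, by continuous logarithms (A. Hatcher,
*Algebraic Topology* (2002), §1.1 Thm. 1.7 and Prop. 1.30; S. Eilenberg, Fund. Math. 26 (1936)),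
in the language of `Literature/Topology/PlaneTopology/WindingNumber.lean`, `AnnulusLogarithm.lean`
and `ZerosPersist.lean`.
* `HelperPlanarIndexZeroExtension.exists_extension_of_wind_eq_zero` — **filling one hole**: if
  `g` is continuous and zero-free on `S ∖ B(c, ρ)`, `S ⊇` the circle `‖z - c‖ = ρ`, and
  `wind (g ∘ circleLoop c ρ) = 0`, then `g` has a continuous logarithm `L` on the circle
  (`hasLogOn_sphere_of_wind_eq_zero`); extend `L` to `L̃ ∈ C(ℂ, ℂ)` (Tietze) and glue `g` (on
  `ρ ≤ ‖z - c‖`) with `exp ∘ L̃` (inside): the glued map is continuous on `S` (`ContinuousOn.if`,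
  the two pieces agree on the circle), zero-free, and equal to `g` on `ρ ≤ ‖z - c‖`.
* `HelperPlanarIndexZeroExtension.wind_eq_zero_of_sum_wind_eq_zero` — **the outer circle does
  not wind**: with the local indices `ι ζ = wind (φ ∘ circleLoop ζ r)` put
  `g z = φ z · ∏_{ζ ∈ Z} (z - ζ) ^ (-ι ζ)`.  About each puncture
  `wind (g ∘ circleLoop ζ r) = ι ζ - ι ζ · 1 - ∑_{ζ' ≠ ζ} ι ζ' · 0 = 0` (`wind_mul`,
  `wind_finset_prod`, `wind_zpow`, `wind_circleLoop_sub_of_norm_lt`,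
  `wind_circleLoop_sub_of_lt_norm`), so filling the holes one at a time (induction over `Z`)
  yields `ĝ` continuous and zero-free on the whole closed disc and equal to `g` off the small open
  discs; `ĝ` has a logarithm on the closed disc (`hasLogOn_closedBall`), hence
  `0 = wind (ĝ ∘ circleLoop 0 R) = wind (g ∘ circleLoop 0 R) = wind (φ ∘ circleLoop 0 R) - ∑ ι ζ`,
  and the last sum is `0` by hypothesis.
* The helper itself is one more hole filling: of `φ` across the disc `‖z‖ < R₀` inside
  `S = closedBall 0 R₁` (no puncture lies on `R₀ ≤ ‖z‖`).

References: A. Hatcher, *Algebraic Topology*, CUP (2002), §1.1 Thm. 1.7, Prop. 1.30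
[HatcherAT2002]; S. Eilenberg, Transformations continues en circonférence et la topologie du plan,
Fund. Math. 26 (1936) [Eilenberg1936].  No new definitions.
-/

noncomputable section

open Set Metric Complex Filter Literature.Topology.PlaneTopology
open scoped Topology Real

-- the prescribed namespace `Summit.<P>.<Sub>.…` duplicates `SmoothPoincare4` (P = Sub)
set_option linter.dupNamespace false

namespace Summit.SmoothPoincare4.SmoothPoincare4.Theorems.GromovRecognitionRelEnd.CrossCapLaurent

namespace HelperPlanarIndexZeroExtension

/-- **Filling one hole.** Let `g` be continuous and zero-free on `S ∖ B(c, ρ)` (`ρ > 0`), where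
`S` contains the circle `‖z - c‖ = ρ`, and suppose the loop `g ∘ circleLoop c ρ` does not wind
about `0`. Then there is `G` continuous and zero-free on all of `S` with `G = g` on `ρ ≤ ‖z - c‖`:
glue `g` with `exp ∘ L̃`, `L̃` a Tietze extension of a continuous logarithm of `g` on the circle
(`hasLogOn_sphere_of_wind_eq_zero`). [folklore] -/
theorem exists_extension_of_wind_eq_zero {S : Set ℂ} {g : ℂ → ℂ} {c : ℂ} {ρ : ℝ} (hρ : 0 < ρ)
    (hS : sphere c ρ ⊆ S) (hg : ContinuousOn g (S \ ball c ρ))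
    (hne : ∀ z ∈ S \ ball c ρ, g z ≠ 0) (hw : wind (fun t => g (circleLoop c ρ t)) = 0) :
    ∃ G : ℂ → ℂ, ContinuousOn G S ∧ (∀ z ∈ S, G z ≠ 0) ∧ ∀ z : ℂ, ρ ≤ ‖z - c‖ → G z = g z := by
  classical
  have hsph : sphere c ρ ⊆ S \ ball c ρ := fun z hz =>
    ⟨hS hz, fun hb => (mem_ball.1 hb).ne (mem_sphere.1 hz)⟩
  obtain ⟨L, hLc, hLe⟩ := hasLogOn_sphere_of_wind_eq_zero hρ (hg.mono hsph)
    (fun z hz => hne z (hsph hz)) hw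
  -- Tietze extension of the logarithm on the circle
  obtain ⟨Lt, hLt⟩ := ContinuousMap.exists_restrict_eq isClosed_sphere
    (⟨fun x : sphere c ρ => L x, hLc.restrict⟩ : C(sphere c ρ, ℂ))
  have hLtL : ∀ x ∈ sphere c ρ, Lt x = L x := fun x hx => by
    have := congrArg (fun F : C(sphere c ρ, ℂ) => F ⟨x, hx⟩) hLt
    simpa using this
  have hcn : Continuous fun z : ℂ => ‖z - c‖ := by fun_prop
  have hout : ∀ z ∈ S, ρ ≤ ‖z - c‖ → z ∈ S \ ball c ρ := fun z hzS hz =>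
    ⟨hzS, fun hb => not_lt.2 hz (by rwa [mem_ball, dist_eq_norm] at hb)⟩
  refine ⟨fun z => if ρ ≤ ‖z - c‖ then g z else exp (Lt z), ?_, ?_, fun z hz => ?_⟩
  · refine ContinuousOn.if ?_ ?_ ?_
    · rintro z ⟨-, hzf⟩
      have hz : ρ = ‖z - c‖ := frontier_le_subset_eq continuous_const hcn hzf
      have hzs : z ∈ sphere c ρ := mem_sphere_iff_norm.2 hz.symm
      rw [hLtL z hzs, hLe z hzs]
    · refine hg.mono ?_
      rintro z ⟨hzS, hz⟩
      rw [(isClosed_le continuous_const hcn).closure_eq] at hz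
      exact hout z hzS hz
    · exact (continuous_exp.comp Lt.continuous).continuousOn
  · intro z hzS
    dsimp only
    split_ifs with h
    · exact hne z (hout z hzS h)
    · exact exp_ne_zero _
  · dsimp only
    rw [if_pos hz]

/-- **The outer circle does not wind.** Let `φ` be continuous and zero-free on the closed disc
`‖z‖ ≤ R` minus a finite set `Z` of punctures whose closed `r`-discs lie in `‖z‖ < R` and are
pairwise disjoint. If the winding numbers of `φ` about the punctures add up to `0`, then
`wind (φ ∘ circleLoop 0 R) = 0` (divide `φ` by `∏ (z - ζ) ^ (ι ζ)`, fill the holes one at a time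
with `exists_extension_of_wind_eq_zero`, and use that a zero-free map on the closed disc has a
logarithm, `hasLogOn_closedBall`). [folklore] -/
theorem wind_eq_zero_of_sum_wind_eq_zero {φ : ℂ → ℂ} {Z : Finset ℂ} {R r : ℝ} (hR : 0 < R)
    (hr : 0 < r) (hZ : ∀ ζ ∈ Z, ‖ζ‖ + r < R)
    (hsep : ∀ ζ ∈ Z, ∀ ζ' ∈ Z, ζ ≠ ζ' → 2 * r < ‖ζ - ζ'‖)
    (hφ : ContinuousOn φ (closedBall 0 R \ ↑Z))
    (hφ0 : ∀ z ∈ closedBall (0 : ℂ) R \ ↑Z, φ z ≠ 0)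
    (hsum : ∑ ζ ∈ Z, wind (fun t => φ (circleLoop ζ r t)) = 0) :
    wind (fun t => φ (circleLoop 0 R t)) = 0 := by
  classical
  -- the local indices `ι` and the corrected map `g = φ · ∏ (z - ζ) ^ (-ι ζ)`
  obtain ⟨ι, hι⟩ : ∃ ι : ℂ → ℤ, ∀ ζ, ι ζ = wind (fun t => φ (circleLoop ζ r t)) :=
    ⟨_, fun _ => rfl⟩
  obtain ⟨g, hg⟩ : ∃ g : ℂ → ℂ, ∀ z, g z = φ z * ∏ ζ ∈ Z, (z - ζ) ^ (-ι ζ) :=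
    ⟨_, fun _ => rfl⟩
  have hZn : ∀ ζ ∈ Z, ‖ζ‖ < R := fun ζ hζ => by linarith [hZ ζ hζ]
  have hne_of : ∀ z : ℂ, z ∉ (↑Z : Set ℂ) → ∀ ζ ∈ Z, z - ζ ≠ 0 := fun z hz ζ hζ =>
    sub_ne_zero.2 fun h => hz (by rw [h]; exact Finset.mem_coe.2 hζ)
  -- `g` is continuous and zero-free off the punctures
  have hgc : ContinuousOn g (closedBall 0 R \ ↑Z) := by
    have e : g = fun z => φ z * ∏ ζ ∈ Z, (z - ζ) ^ (-ι ζ) := funext hg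
    rw [e]
    refine hφ.mul (continuousOn_finsetProd Z fun ζ hζ => ?_)
    exact ContinuousOn.zpow₀ (f := fun z : ℂ => z - ζ) (by fun_prop) _ fun z hz =>
      Or.inl (hne_of z hz.2 ζ hζ)
  have hg0 : ∀ z ∈ closedBall (0 : ℂ) R \ ↑Z, g z ≠ 0 := fun z hz => by
    rw [hg]
    exact mul_ne_zero (hφ0 z hz)
      (Finset.prod_ne_zero_iff.2 fun ζ hζ => zpow_ne_zero _ (hne_of z hz.2 ζ hζ))
  -- the small circles about the punctures stay in the punctured disc
  have hcs : ∀ ζ ∈ Z, ∀ t, ‖circleLoop ζ r t - ζ‖ = r := fun ζ _ t => by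
    rw [norm_circleLoop_sub_center, abs_of_pos hr]
  have hcm : ∀ ζ ∈ Z, ∀ t, circleLoop ζ r t ∈ closedBall (0 : ℂ) R \ ↑Z := by
    intro ζ hζ t
    refine ⟨mem_closedBall_zero_iff.2 ?_, fun hmem => ?_⟩
    · have := norm_sub_norm_le (circleLoop ζ r t) ζ
      linarith [hZ ζ hζ, hcs ζ hζ t]
    · have hζ' : circleLoop ζ r t ∈ Z := Finset.mem_coe.1 hmem
      by_cases heq : circleLoop ζ r t = ζ
      · have := hcs ζ hζ t
        rw [heq, sub_self, norm_zero] at this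
        exact hr.ne this
      · have := hsep _ hζ' ζ hζ heq
        linarith [hcs ζ hζ t]
  -- the base loops `t ↦ circleLoop c ρ t - a`
  have hbase : ∀ (c a : ℂ) (ρ : ℝ), ‖c - a‖ ≠ |ρ| →
      IsNonvanishingLoop fun t => circleLoop c ρ t - a := fun c a ρ h =>
    (isNonvanishingLoop_circleLoop h).congr fun t _ => (circleLoop_sub c a ρ t).symm
  -- Step 1: `g` does not wind about the punctures
  have hgw : ∀ ζ ∈ Z, wind (fun t => g (circleLoop ζ r t)) = 0 := by
    intro ζ hζ
    have hφl : IsNonvanishingLoop fun t => φ (circleLoop ζ r t) :=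
      ⟨hφ.comp (continuous_circleLoop ζ r).continuousOn fun t _ => hcm ζ hζ t,
        fun t _ => hφ0 _ (hcm ζ hζ t), by rw [circleLoop_zero_eq]⟩
    have hb : ∀ ζ' ∈ Z, IsNonvanishingLoop fun t => circleLoop ζ r t - ζ' := by
      intro ζ' hζ'
      refine hbase ζ ζ' r ?_
      rw [abs_of_pos hr]
      by_cases hne : ζ = ζ'
      · rw [hne, sub_self, norm_zero]
        exact hr.ne
      · have := hsep ζ hζ ζ' hζ' hne
        exact (show r < ‖ζ - ζ'‖ by linarith).ne'
    obtain ⟨hPl, hPw⟩ := Literature.Analysis.Complex.ArgPrinciple.wind_finset_prod Z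
      (fun ζ' t => (circleLoop ζ r t - ζ') ^ (-ι ζ')) fun ζ' hζ' => (hb ζ' hζ').zpow _
    have e : (fun t => g (circleLoop ζ r t)) =
        fun t => φ (circleLoop ζ r t) * ∏ ζ' ∈ Z, (circleLoop ζ r t - ζ') ^ (-ι ζ') :=
      funext fun t => hg _
    rw [e, wind_mul hφl hPl, hPw, Finset.sum_eq_single_of_mem ζ hζ fun ζ' hζ' hne => ?_]
    · rw [wind_zpow (hb ζ hζ), wind_circleLoop_sub_of_norm_lt (by rwa [sub_self, norm_zero]),
        mul_one, ← hι ζ]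
      omega
    · rw [wind_zpow (hb ζ' hζ'), wind_circleLoop_sub_of_lt_norm hr.le ?_, mul_zero]
      have := hsep ζ' hζ' ζ hζ hne
      linarith
  -- Step 2: fill the holes one at a time
  have hfill : ∀ T : Finset ℂ, T ⊆ Z → ∃ h : ℂ → ℂ,
      ContinuousOn h (closedBall 0 R \ ((Z \ T : Finset ℂ) : Set ℂ)) ∧
      (∀ z ∈ closedBall (0 : ℂ) R \ ((Z \ T : Finset ℂ) : Set ℂ), h z ≠ 0) ∧
      ∀ z : ℂ, (∀ ζ ∈ T, r ≤ ‖z - ζ‖) → h z = g z := by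
    intro T
    induction T using Finset.induction_on with
    | empty =>
      intro _
      refine ⟨g, ?_, ?_, fun z _ => rfl⟩
      · rwa [Finset.sdiff_empty]
      · rwa [Finset.sdiff_empty]
    | insert a T haT ih =>
      intro hins
      have haZ : a ∈ Z := hins (Finset.mem_insert_self a T)
      have hTZ : T ⊆ Z := (Finset.subset_insert a T).trans hins
      obtain ⟨h, hhc, hh0, hhg⟩ := ih hTZ
      have hca : ∀ t, ‖circleLoop a r t - a‖ = r := hcs a haZ
      -- the circle about `a` lies in the new region, which off `B(a, r)` is inside the old one
      have h1 : sphere a r ⊆ closedBall (0 : ℂ) R \ ((Z \ insert a T : Finset ℂ) : Set ℂ) := by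
        intro z hz
        rw [mem_sphere_iff_norm] at hz
        refine ⟨mem_closedBall_zero_iff.2 ?_, fun hmem => ?_⟩
        · have := norm_sub_norm_le z a
          linarith [hZ a haZ]
        · rw [Finset.mem_coe, Finset.mem_sdiff, Finset.mem_insert, not_or] at hmem
          have := hsep z hmem.1 a haZ hmem.2.1
          linarith
      have hsub : (closedBall (0 : ℂ) R \ ((Z \ insert a T : Finset ℂ) : Set ℂ)) \ ball a r ⊆
          closedBall 0 R \ ((Z \ T : Finset ℂ) : Set ℂ) := by
        rintro z ⟨⟨hzB, hzZ⟩, hzb⟩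
        refine ⟨hzB, fun hmem => ?_⟩
        rw [Finset.mem_coe, Finset.mem_sdiff] at hmem
        by_cases hza : z = a
        · exact hzb (by rw [hza]; exact mem_ball_self hr)
        · refine hzZ ?_
          rw [Finset.mem_coe, Finset.mem_sdiff, Finset.mem_insert, not_or]
          exact ⟨hmem.1, hza, hmem.2⟩
      have h4 : wind (fun t => h (circleLoop a r t)) = 0 := by
        rw [← hgw a haZ]
        refine wind_congr fun t _ => hhg _ fun ζ hζ => ?_
        have hζa : a ≠ ζ := fun h' => haT (by rwa [h'])
        have h2r := hsep a haZ ζ (hTZ hζ) hζa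
        have htri := dist_triangle a (circleLoop a r t) ζ
        simp only [dist_eq_norm] at htri
        rw [norm_sub_rev a (circleLoop a r t), hca t] at htri
        linarith
      obtain ⟨G, hGc, hG0, hGh⟩ :=
        exists_extension_of_wind_eq_zero hr h1 (hhc.mono hsub) (fun z hz => hh0 z (hsub hz)) h4
      refine ⟨G, hGc, hG0, fun z hz => ?_⟩
      rw [hGh z (hz a (Finset.mem_insert_self a T)),
        hhg z fun ζ hζ => hz ζ (Finset.mem_insert_of_mem hζ)]
  obtain ⟨G, hGc, hG0, hGg⟩ := hfill Z (Finset.Subset.refl Z)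
  rw [Finset.sdiff_self, Finset.coe_empty, Set.sdiff_empty] at hGc hG0
  -- Step 3: the filled map has a logarithm on the closed disc, so `g` does not wind along `‖z‖ = R`
  have hcR : ∀ t, ‖circleLoop 0 R t‖ = R := fun t => by
    simpa only [sub_zero, abs_of_pos hR] using norm_circleLoop_sub_center 0 R t
  have hγ : ∀ t, circleLoop 0 R t ∈ closedBall (0 : ℂ) R \ ↑Z := fun t =>
    ⟨mem_closedBall_zero_iff.2 (hcR t).le, fun hmem => by
      have := hZn _ (Finset.mem_coe.1 hmem)
      linarith [hcR t]⟩
  have hGw : wind (fun t => g (circleLoop 0 R t)) = 0 := by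
    have h0 := wind_comp_eq_zero_of_hasLogOn (γ := circleLoop 0 R) (hasLogOn_closedBall hGc hG0)
      (continuous_circleLoop 0 R).continuousOn (fun t _ => (hγ t).1) (circleLoop_zero_eq 0 R)
    refine (wind_congr fun t _ => ?_).trans h0
    refine (hGg _ fun ζ hζ => ?_).symm
    have := norm_sub_norm_le (circleLoop 0 R t) ζ
    linarith [hZ ζ hζ, hcR t]
  -- Step 4: `wind (g ∘ γ) = wind (φ ∘ γ) - ∑ ι ζ` along the outer circle `γ`
  have hφL : IsNonvanishingLoop fun t => φ (circleLoop 0 R t) :=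
    ⟨hφ.comp (continuous_circleLoop 0 R).continuousOn fun t _ => hγ t,
      fun t _ => hφ0 _ (hγ t), by rw [circleLoop_zero_eq]⟩
  have hB : ∀ ζ ∈ Z, IsNonvanishingLoop fun t => circleLoop 0 R t - ζ := fun ζ hζ =>
    hbase 0 ζ R (by rw [zero_sub, norm_neg, abs_of_pos hR]; exact (hZn ζ hζ).ne)
  obtain ⟨hPl, hPw⟩ := Literature.Analysis.Complex.ArgPrinciple.wind_finset_prod Z
    (fun ζ t => (circleLoop 0 R t - ζ) ^ (-ι ζ)) fun ζ hζ => (hB ζ hζ).zpow _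
  have e : (fun t => g (circleLoop 0 R t)) =
      fun t => φ (circleLoop 0 R t) * ∏ ζ ∈ Z, (circleLoop 0 R t - ζ) ^ (-ι ζ) :=
    funext fun t => hg _
  have hs : ∑ ζ ∈ Z, wind (fun t => (circleLoop 0 R t - ζ) ^ (-ι ζ)) = -∑ ζ ∈ Z, ι ζ := by
    rw [← Finset.sum_neg_distrib]
    refine Finset.sum_congr rfl fun ζ hζ => ?_
    rw [wind_zpow (hB ζ hζ), wind_circleLoop_sub_of_norm_lt (by rw [sub_zero]; exact hZn ζ hζ),
      mul_one]
  have hsum' : ∑ ζ ∈ Z, ι ζ = 0 := by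
    rw [← hsum]
    exact Finset.sum_congr rfl fun ζ _ => hι ζ
  rw [e, wind_mul hφL hPl, hPw, hs] at hGw
  linarith

end HelperPlanarIndexZeroExtension

open HelperPlanarIndexZeroExtension

/-- **Registered helper `helper_planarIndexZeroExtension`: a zero-free planar map of total index
zero extends across its punctures.** Let `φ` be continuous and zero-free on the closed disc
`‖z‖ ≤ R₁` minus a finite set `Z` of punctures, every `ζ ∈ Z` with `‖ζ‖ + r < R₀ < R₁`, the
punctures pairwise more than `2r` apart, and `∑_{ζ ∈ Z} wind (φ ∘ circleLoop ζ r) = 0`. Then there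
is `ψ` continuous and zero-free on the closed disc `‖z‖ ≤ R₁` with `ψ z = φ z` whenever
`R₀ ≤ ‖z‖` (the outer circle `‖z‖ = R₀` does not wind, `wind_eq_zero_of_sum_wind_eq_zero`, so the
hole `‖z‖ < R₀` can be filled, `exists_extension_of_wind_eq_zero`).
[cite: HatcherAT2002, §1.1 Thm. 1.7, Prop. 1.30] -/
theorem helper_planarIndexZeroExtension : ∀ (φ : ℂ → ℂ) (Z : Finset ℂ) (R₀ R₁ r : ℝ), 0 < R₀ → R₀ < R₁ → 0 < r → (∀ ζ ∈ Z, ‖ζ‖ + r < R₀) → (∀ ζ ∈ Z, ∀ ζ' ∈ Z, ζ ≠ ζ' → 2 * r < ‖ζ - ζ'‖) → ContinuousOn φ (Metric.closedBall 0 R₁ \ ↑Z) → (∀ z ∈ Metric.closedBall (0 : ℂ) R₁ \ ↑Z, φ z ≠ 0) → ∑ ζ ∈ Z, Literature.Topology.PlaneTopology.wind (fun t => φ (Literature.Topology.PlaneTopology.circleLoop ζ r t)) = 0 → ∃ ψ : ℂ → ℂ, ContinuousOn ψ (Metric.closedBall 0 R₁) ∧ (∀ z ∈ Metric.closedBall (0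 : ℂ) R₁, ψ z ≠ 0) ∧ ∀ z : ℂ, R₀ ≤ ‖z‖ → ψ z = φ z := by
  intro φ Z R₀ R₁ r hR₀ hR₀₁ hr hZ hsep hφ hφ0 hsum
  have hZn : ∀ ζ ∈ Z, ‖ζ‖ < R₀ := fun ζ hζ => by linarith [hZ ζ hζ]
  -- the smaller punctured disc, and the puncture-free annulus `R₀ ≤ ‖z‖ ≤ R₁`
  have hsub0 : closedBall (0 : ℂ) R₀ \ ↑Z ⊆ closedBall 0 R₁ \ ↑Z :=
    Set.sdiff_subset_sdiff_left (closedBall_subset_closedBall hR₀₁.le)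
  have hsub1 : closedBall (0 : ℂ) R₁ \ ball 0 R₀ ⊆ closedBall 0 R₁ \ ↑Z := by
    rintro z ⟨hzB, hzb⟩
    refine ⟨hzB, fun hmem => hzb ?_⟩
    rw [mem_ball_zero_iff]
    exact hZn z (Finset.mem_coe.1 hmem)
  -- the outer circle `‖z‖ = R₀` does not wind, so the hole `‖z‖ < R₀` can be filled
  have hw : wind (fun t => φ (circleLoop 0 R₀ t)) = 0 :=
    wind_eq_zero_of_sum_wind_eq_zero hR₀ hr hZ hsep (hφ.mono hsub0)
      (fun z hz => hφ0 z (hsub0 hz)) hsum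
  obtain ⟨ψ, hψc, hψ0, hψφ⟩ := exists_extension_of_wind_eq_zero (S := closedBall (0 : ℂ) R₁) hR₀
    (sphere_subset_closedBall.trans (closedBall_subset_closedBall hR₀₁.le)) (hφ.mono hsub1)
    (fun z hz => hφ0 z (hsub1 hz)) hw
  exact ⟨ψ, hψc, hψ0, fun z hz => hψφ z (by rwa [sub_zero])⟩

end Summit.SmoothPoincare4.SmoothPoincare4.Theorems.GromovRecognitionRelEnd.CrossCapLaurent

end
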